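import Literature.MathematicalPhysics.QuantumLattice.TIGroundEnergyDensityConservedDensities
import Literature.MathematicalPhysics.QuantumLattice.InfVolFermionStateWeakLimits
import HarnessLib

/-!
# EXISTENCE OF GROUND STATES in every sequentially closed class of infinite-volume fermion states:
# fixed-filling minimisers and minimisers at prescribed conserved densities — for every interaction,
# in every dimension (weak-⋆ compactness + closed constraints)

Topic `Literature/MathematicalPhysics/QuantumLattice` (model-free, general `d`). Companion of
`InfVolFermionStateCompactness.lean` (the same Cantor–Tychonoff diagonal argument for translation-averaged
TORUS vectors, `exists_isTorusLimitOf_subseq`) and of the variational layer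
`TIGroundEnergyDensityCouplingFamilies.lean` / `TIGroundEnergyDensityConservedDensities.lean`
(`infMeanEnergyOn S Ψ R`, class minimisers `IsMinOn`, `tiGroundEnergyDensityAt`, `tiClassWith`), whose
tangent-plane, cross-variational, ensemble and transport theorems take a class MINIMISER as a hypothesis.
Here that hypothesis is discharged once and for all:

The sequential Banach–Alaoglu theorem itself (`InfVolFermionState.exists_tendsto_expect_subseq`), the
closedness of translation invariance (`isTranslationInvariant_of_tendsto_expect`), the continuity of the
mean energy (`tendsto_meanEnergy_of_tendsto_expect`) and the existence of UNCONSTRAINED translation-invariant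
minimisers (`FermionInteraction.exists_isMeanEnergyMinimiser`) are the tree's
`InfVolFermionStateWeakLimits.lean` (REUSED). This file adds the CONSTRAINED classes:

* §2 CLOSED CONDITIONS: densities converge along weak-⋆ convergent sequences (`tendsto_density`); every
  constraint class `tiClassWith C R c` (prescribed conserved densities) and every filling class is
  sequentially closed (`mem_tiClassWith_of_tendsto`, `mem_filling_of_tendsto`).
* §3 EXISTENCE OF MINIMISERS: on every non-empty sequentially closed class `S` the mean energy of every
  interaction attains its infimum (`FermionInteraction.exists_isMinOn_of_seqClosed`: a minimising
  sequence, compactness, closedness, continuity); instances `exists_isMinOn_tiClassWith` (every realised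
  charge vector) and `exists_isMinOn_filling` (every realised filling), so `e_ρ(Ψ)` is ATTAINED:
  `tiGroundEnergyDensityAt Ψ R ρ = e_Ψ(ω)` for some translation-invariant `ω` of density `ρ`
  (`exists_meanEnergy_eq_tiGroundEnergyDensityAt`) — the minimiser hypotheses of the tangent-plane,
  cross-variational, ensemble and transport theorems of the coupling-family files are discharged in every
  dimension and for every interaction.

Everything is PROVED; no definition, no named fact, no number, no `sorry`. HONEST SCOPE: existence only
(no uniqueness, no ergodic decomposition); limits are along subsequences; nothing model-specific.

## Mathlib / tree search

Mathlib: `tendsto_nhds_unique`, `exists_seq_tendsto_sInf`. Tree (REUSED): `exists_tendsto_expect_subseq`,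
`isTranslationInvariant_of_tendsto_expect`, `tendsto_meanEnergy_of_tendsto_expect`
(`InfVolFermionStateWeakLimits`), `infMeanEnergyOn`, `bddBelow_meanEnergy_image_on`, `isMinOn_meanEnergy_iff`,
`meanEnergy_eq_infMeanEnergyOn_of_isMinOn`, `tiClassWith`. `lean search 'exists_isMinOn|filling.*tendsto'`: none;
`exists_isMeanEnergyMinimiser` exists (WeakLimits) and is not restated.

## References

* O. Bratteli, D. W. Robinson, *OAQSM 1* (1987), Thm. 2.3.15 (the state space is weak-⋆ compact) and
  §4.3.1. [cite: BratteliRobinsonI1987, Thm. 2.3.15 (weak-⋆ compactness of the state space) and §4.3.1]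
* O. Bratteli, A. Kishimoto, D. W. Robinson, Commun. Math. Phys. 64 (1978) 41, Thm. 2 (existence and
  characterisation of translation-invariant ground states as minimisers of the mean energy).
  [cite: BratteliKishimotoRobinson1978, Thm. 2]
* D. Ruelle, *Statistical Mechanics* (1969), §3.4. [cite: Ruelle1969, §3.4]
-/

noncomputable section

namespace Literature.MathematicalPhysics.QuantumLattice

open Matrix Finset HubbardWave0 Literature.Probability.LatticeModels ThermodynamicLimit
open _root_.Filter
open scoped _root_.Topology ComplexOrder BigOperators

variable {d : ℕ}

namespace InfVolFermionState

/-! ### §2. Closed conditions -/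

variable {ωs : ℕ → InfVolFermionState d} {ω : InfVolFermionState d}

/-- **Densities converge along weak-⋆ convergent sequences.** [cite: ArakiMoriya2003, §4.1] -/
theorem tendsto_density
    (hlim : ∀ (Λ : Finset (Site d)) (A : FermionOp Λ),
      Tendsto (fun j => (ωs j).expect Λ A) atTop (𝓝 (ω.expect Λ A))) :
    Tendsto (fun j => (ωs j).density) atTop (𝓝 ω.density) :=
  (Complex.continuous_re.tendsto _).comp (hlim _ _)

/-- **Constraint classes are sequentially closed**: a weak-⋆ limit of translation-invariant states with
charges `c` is translation invariant with charges `c`. [cite: Ruelle1969, §3.4] -/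
theorem mem_tiClassWith_of_tendsto {κ : Type*} (C : κ → FermionInteraction d) (R : ℝ) (c : κ → ℝ)
    (hlim : ∀ (Λ : Finset (Site d)) (A : FermionOp Λ),
      Tendsto (fun j => (ωs j).expect Λ A) atTop (𝓝 (ω.expect Λ A)))
    (hmem : ∀ j, ωs j ∈ tiClassWith C R c) : ω ∈ tiClassWith C R c := by
  refine ⟨isTranslationInvariant_of_tendsto_expect hlim fun j => (hmem j).1, fun k => ?_⟩
  refine tendsto_nhds_unique (tendsto_meanEnergy_of_tendsto_expect hlim (C k) R) ?_
  refine (tendsto_const_nhds (x := c k)).congr' (Eventually.of_forall fun j => ?_)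
  exact ((hmem j).2 k).symm

/-- The filling class is sequentially closed. [cite: Ruelle1969, §3.4] -/
theorem mem_filling_of_tendsto (ρ : ℝ)
    (hlim : ∀ (Λ : Finset (Site d)) (A : FermionOp Λ),
      Tendsto (fun j => (ωs j).expect Λ A) atTop (𝓝 (ω.expect Λ A)))
    (hmem : ∀ j, ωs j ∈ {σ : InfVolFermionState d | σ.IsTranslationInvariant ∧ σ.density = ρ}) :
    ω ∈ {σ : InfVolFermionState d | σ.IsTranslationInvariant ∧ σ.density = ρ} := by
  refine ⟨isTranslationInvariant_of_tendsto_expect hlim fun j => (hmem j).1, ?_⟩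
  refine tendsto_nhds_unique (tendsto_density hlim) ?_
  refine (tendsto_const_nhds (x := ρ)).congr' (Eventually.of_forall fun j => ?_)
  exact (hmem j).2.symm

end InfVolFermionState

/-! ### §3. Existence of minimisers -/

namespace FermionInteraction

/-- **The mean energy attains its infimum on every non-empty sequentially closed class**: a minimising
sequence (`exists_seq_tendsto_sInf`), a weak-⋆ convergent subsequence (§1), closedness (`hclosed`), and
continuity of the mean energy (§2). [cite: BratteliKishimotoRobinson1978, Thm. 2] -/
theorem exists_isMinOn_of_seqClosed {S : Set (InfVolFermionState d)} (hS : S.Nonempty)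
    (hclosed : ∀ (ωs : ℕ → InfVolFermionState d) (ω : InfVolFermionState d), (∀ j, ωs j ∈ S) →
      (∀ (Λ : Finset (Site d)) (A : FermionOp Λ),
        Tendsto (fun j => (ωs j).expect Λ A) atTop (𝓝 (ω.expect Λ A))) → ω ∈ S)
    (Ψ : FermionInteraction d) (R : ℝ) :
    ∃ ω ∈ S, IsMinOn (fun σ : InfVolFermionState d => σ.meanEnergy Ψ R) S ω := by
  obtain ⟨u, -, hu, hmem⟩ := exists_seq_tendsto_sInf (hS.image fun σ : InfVolFermionState d =>
    σ.meanEnergy Ψ R) (bddBelow_meanEnergy_image_on S Ψ R)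
  choose ωs hωsS hωse using fun n => (Set.mem_image _ _ _).1 (hmem n)
  obtain ⟨φ, hφ, ω, hlim⟩ := InfVolFermionState.exists_tendsto_expect_subseq ωs
  have hωS : ω ∈ S := hclosed (fun j => ωs (φ j)) ω (fun j => hωsS (φ j)) hlim
  refine ⟨ω, hωS, (isMinOn_meanEnergy_iff Ψ R hωS).2 (le_of_eq ?_)⟩
  -- `e(ω) = lim e(ωs (φ j)) = lim u (φ j) = inf`
  have h1 : Tendsto (fun j => (ωs (φ j)).meanEnergy Ψ R) atTop (𝓝 (ω.meanEnergy Ψ R)) :=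
    InfVolFermionState.tendsto_meanEnergy_of_tendsto_expect hlim Ψ R
  have h2 : Tendsto (fun j => (ωs (φ j)).meanEnergy Ψ R) atTop (𝓝 (infMeanEnergyOn S Ψ R)) := by
    have h := hu.comp hφ.tendsto_atTop
    refine h.congr' (Eventually.of_forall fun j => ?_)
    simp only [Function.comp_apply, hωse]
  exact tendsto_nhds_unique h1 h2

/-- **Minimisers at prescribed conserved densities exist** for every realised charge vector.
[cite: Ruelle1969, §3.4] -/
theorem exists_isMinOn_tiClassWith {κ : Type*} (C : κ → FermionInteraction d) (R : ℝ) {c : κ → ℝ}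
    (hne : (InfVolFermionState.tiClassWith C R c).Nonempty) (Ψ : FermionInteraction d) :
    ∃ ω ∈ InfVolFermionState.tiClassWith C R c,
      IsMinOn (fun σ : InfVolFermionState d => σ.meanEnergy Ψ R) (InfVolFermionState.tiClassWith C R c) ω :=
  exists_isMinOn_of_seqClosed hne
    (fun _ _ hmem hlim => InfVolFermionState.mem_tiClassWith_of_tendsto C R c hlim hmem) Ψ R

/-- **Fixed-filling minimisers exist** for every realised filling: the density-constrained variational
density `e_ρ(Ψ)` is ATTAINED by a translation-invariant state of density `ρ`. [cite: Ruelle1969, §3.4] -/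
theorem exists_isMinOn_filling (Ψ : FermionInteraction d) (R : ℝ) {ρ : ℝ}
    (hne : ∃ ω : InfVolFermionState d, ω.IsTranslationInvariant ∧ ω.density = ρ) :
    ∃ ω ∈ {σ : InfVolFermionState d | σ.IsTranslationInvariant ∧ σ.density = ρ},
      IsMinOn (fun σ : InfVolFermionState d => σ.meanEnergy Ψ R)
        {σ : InfVolFermionState d | σ.IsTranslationInvariant ∧ σ.density = ρ} ω :=
  exists_isMinOn_of_seqClosed hne (fun _ _ hmem hlim => InfVolFermionState.mem_filling_of_tendsto ρ hlim hmem) Ψ R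

/-- **`e_ρ(Ψ)` is attained**: for every realised filling there is a translation-invariant `ω` of density
`ρ` with `e_Ψ(ω) = tiGroundEnergyDensityAt Ψ R ρ`. [cite: Ruelle1969, §3.4] -/
theorem exists_meanEnergy_eq_tiGroundEnergyDensityAt (Ψ : FermionInteraction d) (R : ℝ) {ρ : ℝ}
    (hne : ∃ ω : InfVolFermionState d, ω.IsTranslationInvariant ∧ ω.density = ρ) :
    ∃ ω : InfVolFermionState d, ω.IsTranslationInvariant ∧ ω.density = ρ ∧
      ω.meanEnergy Ψ R = Ψ.tiGroundEnergyDensityAt R ρ := by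
  obtain ⟨ω, hω, hmin⟩ := exists_isMinOn_filling Ψ R hne
  exact ⟨ω, hω.1, hω.2, meanEnergy_eq_infMeanEnergyOn_of_isMinOn Ψ R hω hmin⟩

end FermionInteraction

end Literature.MathematicalPhysics.QuantumLattice

end
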